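import Mathlib

/-!
# Asymptotic calculus in the power scale `x^p (1 + O(x^{-1/2}))`

Analysis/ODE support file (everything proved, no definitions). An "asymptotic monomial" on a
half-line `[X, ∞)` (`X ≥ 1`) is a function `φ` with `|φ(x) − a x^p| ≤ K x^{p − 1/2}` (real exponent
`p`, `x^p = Real.rpow x p`). This file records the three closure rules of this scale used in the
asymptotic integration of `u'' = (ℓ(ℓ+1)/x² + W)u`, `W = O(x^{-5/2})`, by variation of parameters:
* `asymp_mul` — products: `φψ` is asymptotic to `ab x^{p+q}`;
* `asymp_integral_Ioi` — decaying tails (`p < −1`): `∫_x^∞ φ` is asymptotic to `a x^{p+1}/(−p−1)`;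
* `asymp_integral_interval` — growing primitives (`p ≥ 0`): `∫_X^x φ` is asymptotic to
  `a x^{p+1}/(p+1)`,
with explicit constants, together with two small helpers of the scale (monotonicity in the exponent,
size of an asymptotic monomial). Folklore (Hartman, *Ordinary Differential Equations*, Ch. X §1).
Revision after review of p81909: the one-line `rpow` restatements were removed (Mathlib's
`Real.rpow_add`, `Real.rpow_neg`, `Real.rpow_natCast`, `Real.sqrt_eq_rpow` are used directly).
-/

noncomputable section

namespace Literature.Analysis.ODE

open MeasureTheory Set Filter Topology Real

/-! ### Conversions -/

/-- Monotonicity in the exponent for `x ≥ 1`: `x^{p − 1/2} ≤ x^p`. [folklore] -/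
theorem rpow_sub_half_le {x : ℝ} (hx : 1 ≤ x) (p : ℝ) : x ^ (p - 1 / 2) ≤ x ^ p :=
  Real.rpow_le_rpow_of_exponent_le hx (by linarith)

/-- A constant in a bound `|r| ≤ K x^s` (`x > 0`) is non-negative. [folklore] -/
theorem nonneg_of_abs_le_mul_rpow {r K x s : ℝ} (hx : 0 < x) (h : |r| ≤ K * x ^ s) : 0 ≤ K := by
  have hxs : 0 < x ^ s := Real.rpow_pos_of_pos hx s
  rcases le_or_gt 0 K with hK | hK
  · exact hK
  · linarith [abs_nonneg r, mul_neg_of_neg_of_pos hK hxs]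

/-- Size of an asymptotic monomial: `|φ(x)| ≤ (|a| + K) x^p` for `x ≥ 1`. [folklore] -/
theorem abs_le_of_asymp {φ : ℝ → ℝ} {a p K x : ℝ} (hx : 1 ≤ x)
    (h : |φ x - a * x ^ p| ≤ K * x ^ (p - 1 / 2)) : |φ x| ≤ (|a| + K) * x ^ p := by
  have hx0 : 0 < x := lt_of_lt_of_le one_pos hx
  have hK : 0 ≤ K := nonneg_of_abs_le_mul_rpow hx0 h
  have hxp : 0 < x ^ p := Real.rpow_pos_of_pos hx0 p
  have h1 : |a * x ^ p| = |a| * x ^ p := by rw [abs_mul, abs_of_pos hxp]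
  calc |φ x| = |(φ x - a * x ^ p) + a * x ^ p| := by ring_nf
    _ ≤ |φ x - a * x ^ p| + |a * x ^ p| := abs_add_le _ _
    _ ≤ K * x ^ (p - 1 / 2) + |a| * x ^ p := by rw [h1]; linarith
    _ ≤ K * x ^ p + |a| * x ^ p := by
        have := rpow_sub_half_le hx p
        nlinarith
    _ = (|a| + K) * x ^ p := by ring

/-! ### Products -/

/-- **Product rule of the scale.** If `|φ − a x^p| ≤ K x^{p−1/2}` and `|ψ − b x^q| ≤ K' x^{q−1/2}` on
`[X, ∞)` (`X ≥ 1`), then `|φψ − ab x^{p+q}| ≤ (K(|b| + K') + |a|K') x^{p+q−1/2}` there. [folklore] -/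
theorem asymp_mul {φ ψ : ℝ → ℝ} {a b p q K K' X : ℝ} (hX : 1 ≤ X)
    (hφ : ∀ x, X ≤ x → |φ x - a * x ^ p| ≤ K * x ^ (p - 1 / 2))
    (hψ : ∀ x, X ≤ x → |ψ x - b * x ^ q| ≤ K' * x ^ (q - 1 / 2)) {x : ℝ} (hx : X ≤ x) :
    |φ x * ψ x - a * b * x ^ (p + q)| ≤ (K * (|b| + K') + |a| * K') * x ^ (p + q - 1 / 2) := by
  have hx1 : 1 ≤ x := hX.trans hx
  have hx0 : 0 < x := lt_of_lt_of_le one_pos hx1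
  have h1 := hφ x hx
  have h2 := hψ x hx
  have hK : 0 ≤ K := nonneg_of_abs_le_mul_rpow hx0 h1
  have hK' : 0 ≤ K' := nonneg_of_abs_le_mul_rpow hx0 h2
  have hψb : |ψ x| ≤ (|b| + K') * x ^ q := abs_le_of_asymp hx1 h2
  have hxp : 0 < x ^ p := Real.rpow_pos_of_pos hx0 p
  -- decomposition
  have e : φ x * ψ x - a * b * x ^ (p + q)
      = (φ x - a * x ^ p) * ψ x + a * x ^ p * (ψ x - b * x ^ q) := by
    rw [Real.rpow_add hx0 p q]; ring
  rw [e]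
  have t1 : |(φ x - a * x ^ p) * ψ x| ≤ K * (|b| + K') * x ^ (p + q - 1 / 2) := by
    rw [abs_mul]
    calc |φ x - a * x ^ p| * |ψ x| ≤ K * x ^ (p - 1 / 2) * ((|b| + K') * x ^ q) :=
          mul_le_mul h1 hψb (abs_nonneg _) (by positivity)
      _ = K * (|b| + K') * (x ^ (p - 1 / 2) * x ^ q) := by ring
      _ = K * (|b| + K') * x ^ (p + q - 1 / 2) := by
          rw [← Real.rpow_add hx0]; ring_nf
  have t2 : |a * x ^ p * (ψ x - b * x ^ q)| ≤ |a| * K' * x ^ (p + q - 1 / 2) := by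
    rw [abs_mul, abs_mul, abs_of_pos hxp]
    calc |a| * x ^ p * |ψ x - b * x ^ q| ≤ |a| * x ^ p * (K' * x ^ (q - 1 / 2)) :=
          mul_le_mul_of_nonneg_left h2 (by positivity)
      _ = |a| * K' * (x ^ p * x ^ (q - 1 / 2)) := by ring
      _ = |a| * K' * x ^ (p + q - 1 / 2) := by
          rw [← Real.rpow_add hx0]; ring_nf
  calc |(φ x - a * x ^ p) * ψ x + a * x ^ p * (ψ x - b * x ^ q)|
      ≤ |(φ x - a * x ^ p) * ψ x| + |a * x ^ p * (ψ x - b * x ^ q)| := abs_add_le _ _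
    _ ≤ K * (|b| + K') * x ^ (p + q - 1 / 2) + |a| * K' * x ^ (p + q - 1 / 2) := add_le_add t1 t2
    _ = (K * (|b| + K') + |a| * K') * x ^ (p + q - 1 / 2) := by ring

/-! ### Decaying tails -/

/-- Continuity of a real power on `[X, ∞)`, `X > 0`. [folklore] -/
theorem continuousOn_rpow_Ici {X : ℝ} (hX : 0 < X) (p : ℝ) :
    ContinuousOn (fun x : ℝ => x ^ p) (Ici X) :=
  continuousOn_id.rpow_const fun _ hx => Or.inl (hX.trans_le hx).ne'

/-- **Tail rule of the scale.** If `φ` is continuous on `[X, ∞)` (`X ≥ 1`) with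
`|φ − a x^p| ≤ K x^{p−1/2}` there and `p < −1`, then for `x ≥ X`, `φ` is integrable on `(x, ∞)` and
`|∫_x^∞ φ − (a/(−p−1)) x^{p+1}| ≤ (K/(−p−1/2)) x^{p+1/2}`. [folklore] -/
theorem asymp_integral_Ioi {φ : ℝ → ℝ} {a p K X : ℝ} (hX : 1 ≤ X) (hφc : ContinuousOn φ (Ici X))
    (hp : p < -1) (hφ : ∀ x, X ≤ x → |φ x - a * x ^ p| ≤ K * x ^ (p - 1 / 2)) {x : ℝ} (hx : X ≤ x) :
    IntegrableOn φ (Ioi x)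
      ∧ |(∫ y in Ioi x, φ y) - a / (-p - 1) * x ^ (p + 1)| ≤ K / (-p - 1 / 2) * x ^ (p + 1 / 2) := by
  have hX0 : 0 < X := lt_of_lt_of_le one_pos hX
  have hx0 : 0 < x := hX0.trans_le hx
  have hK : 0 ≤ K := nonneg_of_abs_le_mul_rpow hX0 (hφ X le_rfl)
  -- the model tail and the remainder
  have hmi : IntegrableOn (fun y : ℝ => a * y ^ p) (Ioi x) :=
    (integrableOn_Ioi_rpow_of_lt hp hx0).const_mul a
  have hri : IntegrableOn (fun y : ℝ => K * y ^ (p - 1 / 2)) (Ioi x) :=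
    (integrableOn_Ioi_rpow_of_lt (by linarith) hx0).const_mul K
  have hmeas : AEStronglyMeasurable (fun y => φ y - a * y ^ p) (volume.restrict (Ioi x)) :=
    ((hφc.mono fun y hy => hx.trans (le_of_lt hy)).sub
      (((continuousOn_rpow_Ici hX0 p).mono fun y hy => hx.trans (le_of_lt hy)).const_smul a
        |>.congr fun y _ => by simp [smul_eq_mul])).aestronglyMeasurable measurableSet_Ioi
  have hrem : IntegrableOn (fun y => φ y - a * y ^ p) (Ioi x) := by
    refine Integrable.mono' hri hmeas ?_
    refine (ae_restrict_iff' measurableSet_Ioi).2 (Eventually.of_forall fun y hy => ?_)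
    rw [Real.norm_eq_abs]
    exact hφ y (hx.trans (le_of_lt hy))
  have hφi : IntegrableOn φ (Ioi x) := by
    have := hrem.add hmi
    exact this.congr_fun (fun y _ => by simp) measurableSet_Ioi
  refine ⟨hφi, ?_⟩
  have hsplit : (∫ y in Ioi x, φ y) = (∫ y in Ioi x, φ y - a * y ^ p) + ∫ y in Ioi x, a * y ^ p := by
    rw [← integral_add hrem hmi]
    exact integral_congr_ae (Eventually.of_forall fun y => by simp)
  have hmodel : (∫ y in Ioi x, a * y ^ p) = a / (-p - 1) * x ^ (p + 1) := by
    rw [integral_const_mul, integral_Ioi_rpow_of_lt hp hx0,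
      show -p - 1 = -(p + 1) by ring, div_neg]
    ring
  rw [hsplit, hmodel, add_sub_cancel_right]
  have hp2 : p - 1 / 2 < -1 := by linarith
  have hne : p - 1 / 2 + 1 ≠ 0 := by linarith
  calc |∫ y in Ioi x, φ y - a * y ^ p| ≤ ∫ y in Ioi x, |φ y - a * y ^ p| :=
        abs_integral_le_integral_abs
    _ ≤ ∫ y in Ioi x, K * y ^ (p - 1 / 2) :=
        setIntegral_mono_on hrem.abs hri measurableSet_Ioi fun y hy => hφ y (hx.trans (le_of_lt hy))
    _ = K * (-x ^ (p - 1 / 2 + 1) / (p - 1 / 2 + 1)) := by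
        rw [integral_const_mul, integral_Ioi_rpow_of_lt hp2 hx0]
    _ = K / (-p - 1 / 2) * x ^ (p + 1 / 2) := by
        have e : p - 1 / 2 + 1 = p + 1 / 2 := by ring
        rw [e, show -p - 1 / 2 = -(p + 1 / 2) by ring, div_neg]
        ring

/-! ### Growing primitives -/

/-- **Primitive rule of the scale.** If `φ` is continuous on `[X, ∞)` (`X ≥ 1`) with
`|φ − a x^p| ≤ K x^{p−1/2}` there and `p ≥ 0`, then for `x ≥ X`
`|∫_X^x φ − (a/(p+1)) x^{p+1}| ≤ (|a| √X/(p+1) + K/(p+1/2)) x^{p+1/2}`. [folklore] -/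
theorem asymp_integral_interval {φ : ℝ → ℝ} {a p K X : ℝ} (hX : 1 ≤ X) (hφc : ContinuousOn φ (Ici X))
    (hp : 0 ≤ p) (hφ : ∀ x, X ≤ x → |φ x - a * x ^ p| ≤ K * x ^ (p - 1 / 2)) {x : ℝ} (hx : X ≤ x) :
    |(∫ y in X..x, φ y) - a / (p + 1) * x ^ (p + 1)|
      ≤ (|a| * Real.sqrt X / (p + 1) + K / (p + 1 / 2)) * x ^ (p + 1 / 2) := by
  have hX0 : 0 < X := lt_of_lt_of_le one_pos hX
  have hx0 : 0 < x := hX0.trans_le hx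
  have hK : 0 ≤ K := nonneg_of_abs_le_mul_rpow hX0 (hφ X le_rfl)
  have hIcc : Icc X x ⊆ Ici X := fun y hy => hy.1
  -- interval integrability on `[X, x]`
  have hφi : IntervalIntegrable φ volume X x :=
    (hφc.mono hIcc).intervalIntegrable_of_Icc hx
  have hmi : IntervalIntegrable (fun y : ℝ => a * y ^ p) volume X x :=
    (((continuousOn_rpow_Ici hX0 p).mono hIcc).intervalIntegrable_of_Icc hx).const_mul a
  have hri : IntervalIntegrable (fun y : ℝ => K * y ^ (p - 1 / 2)) volume X x :=
    (((continuousOn_rpow_Ici hX0 _).mono hIcc).intervalIntegrable_of_Icc hx).const_mul K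
  have hsplit : (∫ y in X..x, φ y) = (∫ y in X..x, φ y - a * y ^ p) + ∫ y in X..x, a * y ^ p := by
    rw [← intervalIntegral.integral_add (hφi.sub hmi) hmi]
    exact intervalIntegral.integral_congr fun y _ => by simp
  have h0 : (0 : ℝ) ∉ uIcc X x := by
    rw [uIcc_of_le hx]; exact fun h => absurd h.1 (not_le.2 hX0)
  have hmodel : (∫ y in X..x, a * y ^ p) = a / (p + 1) * x ^ (p + 1) - a / (p + 1) * X ^ (p + 1) := by
    rw [intervalIntegral.integral_const_mul, integral_rpow (Or.inl (by linarith))]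
    have : p + 1 ≠ 0 := by linarith
    field_simp
  have hrem : |∫ y in X..x, φ y - a * y ^ p| ≤ K / (p + 1 / 2) * x ^ (p + 1 / 2) := by
    calc |∫ y in X..x, φ y - a * y ^ p| ≤ ∫ y in X..x, |φ y - a * y ^ p| :=
          intervalIntegral.abs_integral_le_integral_abs hx
      _ ≤ ∫ y in X..x, K * y ^ (p - 1 / 2) :=
          intervalIntegral.integral_mono_on hx (hφi.sub hmi).abs hri fun y hy => hφ y hy.1
      _ = K * ((x ^ (p - 1 / 2 + 1) - X ^ (p - 1 / 2 + 1)) / (p - 1 / 2 + 1)) := by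
          rw [intervalIntegral.integral_const_mul, integral_rpow (Or.inr ⟨by linarith, h0⟩)]
      _ ≤ K * (x ^ (p + 1 / 2) / (p + 1 / 2)) := by
          refine mul_le_mul_of_nonneg_left ?_ hK
          have e : p - 1 / 2 + 1 = p + 1 / 2 := by ring
          rw [e]
          have hXp : 0 ≤ X ^ (p + 1 / 2) := (Real.rpow_pos_of_pos hX0 _).le
          have hp' : 0 < p + 1 / 2 := by linarith
          rw [div_le_div_iff_of_pos_right hp']
          linarith
      _ = K / (p + 1 / 2) * x ^ (p + 1 / 2) := by ring
  -- the constant of integration `a X^{p+1}/(p+1)` is `≤ |a| √X x^{p+1/2}/(p+1)`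
  have hconst : |a / (p + 1) * X ^ (p + 1)| ≤ |a| * Real.sqrt X / (p + 1) * x ^ (p + 1 / 2) := by
    have hp1 : 0 < p + 1 := by linarith
    rw [abs_mul, abs_div, abs_of_pos hp1, abs_of_pos (Real.rpow_pos_of_pos hX0 _)]
    have hXsplit : X ^ (p + 1) = Real.sqrt X * X ^ (p + 1 / 2) := by
      rw [Real.sqrt_eq_rpow, ← Real.rpow_add hX0]; ring_nf
    have hXx : X ^ (p + 1 / 2) ≤ x ^ (p + 1 / 2) :=
      Real.rpow_le_rpow hX0.le hx (by linarith)
    rw [hXsplit]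
    have : 0 ≤ |a| / (p + 1) * Real.sqrt X := by positivity
    calc |a| / (p + 1) * (Real.sqrt X * X ^ (p + 1 / 2))
        = |a| / (p + 1) * Real.sqrt X * X ^ (p + 1 / 2) := by ring
      _ ≤ |a| / (p + 1) * Real.sqrt X * x ^ (p + 1 / 2) := mul_le_mul_of_nonneg_left hXx this
      _ = |a| * Real.sqrt X / (p + 1) * x ^ (p + 1 / 2) := by ring
  rw [hsplit, hmodel]
  have e3 : ∀ I B C : ℝ, I + (B - C) - B = I - C := fun I B C => by ring
  calc |(∫ y in X..x, φ y - a * y ^ p) + (a / (p + 1) * x ^ (p + 1) - a / (p + 1) * X ^ (p + 1))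
        - a / (p + 1) * x ^ (p + 1)|
      = |(∫ y in X..x, φ y - a * y ^ p) - a / (p + 1) * X ^ (p + 1)| := by rw [e3]
    _ ≤ |∫ y in X..x, φ y - a * y ^ p| + |a / (p + 1) * X ^ (p + 1)| := abs_sub _ _
    _ ≤ K / (p + 1 / 2) * x ^ (p + 1 / 2) + |a| * Real.sqrt X / (p + 1) * x ^ (p + 1 / 2) :=
        add_le_add hrem hconst
    _ = (|a| * Real.sqrt X / (p + 1) + K / (p + 1 / 2)) * x ^ (p + 1 / 2) := by ring

end Literature.Analysis.ODE
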